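import Literature.MathematicalPhysics.QuantumFieldTheory.BalabanImbrieJaffe1984to88.BIJ88Eq5145HeadMultiCube
import Literature.MathematicalPhysics.QuantumFieldTheory.BalabanImbrieJaffe1984to88.BIJ88SlotFieldGaussBounds
import Literature.MathematicalPhysics.QuantumFieldTheory.BalabanImbrieJaffe1984to88.BIJ88Eq5145HeadMultiCubeSlots
import Literature.MathematicalPhysics.QuantumFieldTheory.BalabanImbrieJaffe1984to88.BIJ88SmallChargeRegime

/-!
# `BalabanImbrieJaffe1984to88.BIJ88Eq5145HeadStruct` — T. Bałaban, J. Imbrie, A. Jaffe, *Effective action and cluster properties of the abelian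
Higgs model*, Commun. Math. Phys. **114** (1988) 257–315 [BalabanImbrieJaffe1988], Sect. 5.14, (5.14.5) p. 312 [PDF 56] with (5.14.4) p. 309
[PDF 53]: **THE MULTI-CUBE HEAD OF ROW C2.Eq5.14.5 WITH ITS ONE-CUBE GAUSSIAN TAIL HYPOTHESIS DISCHARGED FROM STRUCTURAL DATA** — p36 gen 15's
`BIJ88Eq5145HeadMultiCube.eq5145_zG_mod_W6v_of_ineq5144_two_le` with the law-level input `htail` (one-cube sub-Gaussian tails `A, κ` of every
χ-slot field) REPLACED by: `Δ ≥ m·1` as a form, Euclidean bounds `|ℓ_j φ| ≤ Λ‖φ‖₂` on the linear functionals behind the slot fields, and the size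
`‖ℱ|_□‖₂ ≤ F` of the source on every cube (p36 gen 16's `BIJ88SlotFieldGaussBounds`).

statement-level skeleton of published theorems with citation tags; proofs where landed; nothing here is a claim about the Yang–Mills mass gap

p. 309, verbatim: *"The bound for H_β = ∅, |X_β| = 1 was obtained for g₂, and the same proof applies here."*; p. 307: *"These derivatives are
supported at |A^{(k)″}| ≧ cp(e_k) or |φ^{(k)″}| ≧ cp(e_k) (here we use the fact that the translation vanishes). Thus we can use the arguments at the
end of Sect. 14 in [3] to extract the factors e^{−cp(e_k)²} from the Gaussian measure."*  PDF held: `paper:balaban1988-cmp114-bij-abelian-higgs-effective-action`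
(journal page = PDF page + 256); pp. 307, 309, 312 = PDF 51, 53, 56 read this generation.

WHAT IS PROVED (unit `lit-balaban-p36`, generation 16 of the Phase-2 proof seat p36; SKELETON row **C2.Eq5.14.5** member cell of
`HOME/lit-balaban-r16/ROWS-C2-part2.md`, owner r16 — a refinement of the successor-head candidate `…_two_le` (p337083; owner's kernel instance
p338195, p36's χ-slot instance `BIJ88Eq5145HeadMultiCubeSlots` p339137); row **C2.Eq5.14.3-5.14.4** member).  §1 **`eq5145_zG_mod_W6v_of_ineq5144_two_le_struct`**: conclusion of the head VERBATIM (`exp[−𝒫^L − Σ_X (W₆′(X) + W₆″(X))]`, `W₆′` as printed);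
hypotheses of `…_two_le` with (i) `hmod` strengthened to carry the Euclidean bounds `|ℓ₁ φ|, |ℓ₂ φ| ≤ Λ‖φ‖₂` of the two linear functionals behind
each χ-slot field (linear `ℓ₁` or modulus `√(ℓ₁² + ℓ₂²)`, p. 308: `(I − Q_s*Q)A^{(k)}`, `φ^{(k)}`), (ii) `hA`, `hκ`, `htail` DELETED in favour of
`m > 0` with `m‖φ‖² ≤ φ·Δφ` and `F ≥ 0` with `‖ℱ|_{□_i}‖₂² ≤ F²` for every cube, (iii) the three regime inequalities that mention the tail constants
written with `A = 4e^{F²/(2m)}`, `κ = m/(8Λ²)`.  Proof: the head applied to the tail supplied by `BIJ88SlotFieldGaussBounds.tail_slotField_fieldLaw_of_struct`.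
§2 **`eq5145_two_le_struct_instance_uniform`** — A KERNEL CERTIFICATE OF §1 WITH A UNIFORM THRESHOLD: for `p > 1/2`, `n̄`, `D` there is
`e₀(p, n̄, D) > 0` such that for EVERY finite cube set `I`, every symmetric abutting relation of degree `≤ D`, every cube-local `F`, the data
«sites = cubes, `Δ = 1`, `ℱ = 0`, one linear χ-slot per cube (the site field), `c ≡ 1`, no interaction terms, `χ = gevreyCutoff`» satisfy EVERY
hypothesis of §1 for all `e_k ∈ (0, e₀)` (`m = Λ = 1`, `F = 0` — so `A = 4`, `κ = 1/8` are ABSOLUTE constants, unlike the datum-dependent variance scale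
of `BIJ88Eq5145HeadMultiCubeSlots.eq5145_two_le_instance`; `θ = √e_k`, `β′ = 1`; `h5144two` by `BIJ88Eq5145HeadMultiCubeSlots.abs_locAct_actIn_le_of_two_le`),
and the (5.14.5) identity holds for them — the threshold chosen BEFORE the datum.
HONEST SCOPE: exactly the candidate head's scope; the multi-cube leaf `h5144two` (the inductive cluster-expansion decay on `|X_β| ≥ 2`), `h311`,
`hsmall`, the bounded terms `|V(Y)| ≤ K_Y` and the finite-dimensional §5.13 model stay displayed; print's numerical sizes of `m, Λ, F` (Sect. 2
covariance bounds, small-field `p(e_k)`) are NOT derived.  0 `sorry`, 0 definitions, 0 `Prop` facts (D-0026); imports `BIJ88Eq5145HeadMultiCube`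
(p36 g15), `BIJ88SlotFieldGaussBounds`, `BIJ88Eq5145HeadMultiCubeSlots` (p36 g16), `BIJ88SmallChargeRegime` (p36 g6); modifies nothing.  NOT summit progress; NOT continuum; NOT Clay.  Cell `lit-balaban` Phase 2,
seat p36 gen 16 (owner r16, referee ref-5).
-/

noncomputable section

open Finset MeasureTheory Matrix ProbabilityTheory Filter
open Literature.MathematicalPhysics.QuantumFieldTheory.BalabanImbrieJaffe1984to88
open BIJ88PolymerRep5134 (g1 IsAdmissible corner)
open BIJ88PolymerRep5134Gauss (ext expect zG src)
open BIJ88Resummation5141 (outer lam12)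
open BIJ88Resummation5141Adm (lam12')
open BIJ88Expansion5143Gauss (fD)
open BIJ88SlotMomentsGauss308 (uD fieldLaw)
open BIJ88Sect2Statements (pLog)
open BIJ88Sect5Statements (CutoffProfile cutoff)
open BIJ88Sect5StatementsPart4 (pertP)
open BIJ88Eq5145CornerModel
open BIJ88Eq5145CornerUrsell (cubeIn)
open BIJ88W6PrimeVsupp (actIn W6v)
open BIJ88Ineq5144Located (locAct)
open BIJ88Eq5145HeadMultiCube (eq5145_zG_mod_W6v_of_ineq5144_two_le)
open BIJ88SlotFieldGaussBounds (tail_slotField_fieldLaw_of_struct tail_constants_eq)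
open BIJ88GaussIntegration309Product (exists_const_all_orders)
open BIJ88CutoffProfileWitness (gevreyCutoff chi1_nonneg)
open BIJ88SmallChargeRegime (exists_threshold eventually_const_le_mul_log_rpow eventually_const_mul_le_one eventually_le_one)
open BIJ88Eq5145HeadMultiCubeSlots (abs_locAct_actIn_le_of_two_le)

namespace Literature.MathematicalPhysics.QuantumFieldTheory.BalabanImbrieJaffe1984to88.BIJ88Eq5145HeadStruct

/-! ## §1 The multi-cube head with structural one-cube tails -/

section Head

variable {α I : Type} [Fintype α] [DecidableEq α] [Fintype I] [DecidableEq I]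
  (blk : α → I) (Δ : Matrix α α ℝ) (ℱ : α → ℝ)
variable (adj : I → I → Prop) [DecidableRel adj]
variable (χ : CutoffProfile) {ι υ : Type*} [DecidableEq ι] [DecidableEq υ]
variable {p ek : ℝ} {B : Finset ι} {Φ : ι → (α → ℝ) → ℝ} {c : ι → ℝ} {Ys : Finset υ} {V : υ → (α → ℝ) → ℝ}
variable (cube : ↥B ⊕ ↥Ys → I) {L : Type*} (γ : L → ↥B ⊕ ↥Ys)

/-- **(5.14.5) ON THE MODEL — THE MULTI-CUBE HEAD WITH THE ONE-CUBE GAUSSIAN TAILS FROM STRUCTURAL DATA** (p. 312 (5.14.5); p. 309 (5.14.4):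
*"The bound for H_β = ∅, |X_β| = 1 was obtained for g₂, and the same proof applies here"*; p. 307: *"we … extract the factors e^{−cp(e_k)²} from the
Gaussian measure … (here we use the fact that the translation vanishes)"*): `BIJ88Eq5145HeadMultiCube.eq5145_zG_mod_W6v_of_ineq5144_two_le` with
its tail input `htail` (and `hA`, `hκ`) replaced by `Δ ≥ m·1` (`hm`, `hΔm`), `|ℓ_j φ| ≤ Λ‖φ‖₂` for the functionals behind every χ-slot field
(inside `hmod`), `‖ℱ|_{□_i}‖₂ ≤ F` (`hF`); tail constants `A = 4e^{F²/(2m)}`, `κ = m/(8Λ²)` in `hreg`/`hpre`/`hvac`; everything else and the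
conclusion verbatim. [cite: BalabanImbrieJaffe1988, (5.14.5) p.312; (5.14.4) p.309; p.307 (Sect. 5.13); p.310 display 4; p.311] -/
theorem eq5145_zG_mod_W6v_of_ineq5144_two_le_struct [Fintype ι] [Fintype υ] {nbr : I → Finset I} {D : ℕ} {θ β' : ℝ}
    (hR : ∀ x y, adj x y → adj y x) (hD : ∀ x, (nbr x).card ≤ D) (hnbr : ∀ x y, adj x y → y ∈ nbr x) (hθ0 : 0 < θ) (hθ1 : θ ≤ 1)
    (hβ : 0 ≤ β') (hsmall : 16 * ((D : ℝ) + 1) ^ 2 * (θ ^ (β' / 2) * Real.exp 2) ≤ 1)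
    (hΔadj : ∀ x y, blk x ≠ blk y → ¬ adj (blk x) (blk y) → Δ x y = 0) (hΔ : Δ.PosDef)
    {m : ℝ} (hm : 0 < m) (hΔm : ∀ φ : α → ℝ, m * (φ ⬝ᵥ φ) ≤ φ ⬝ᵥ (Δ *ᵥ φ))
    (hχ : ∀ x, 0 ≤ χ.χ₁ x) (hp : 1 / 2 < p) {Λ : ℝ} (hΛ : 0 < Λ)
    (hmod : ∀ b ∈ B, ∃ ℓ₁ ℓ₂ : (α → ℝ) → ℝ, IsLinearMap ℝ ℓ₁ ∧ IsLinearMap ℝ ℓ₂ ∧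
      ((∀ φ, Φ b φ = ℓ₁ φ) ∨ (∀ φ, Φ b φ = Real.sqrt (ℓ₁ φ ^ 2 + ℓ₂ φ ^ 2))) ∧
      (∀ φ, |ℓ₁ φ| ≤ Λ * Real.sqrt (φ ⬝ᵥ φ)) ∧ (∀ φ, |ℓ₂ φ| ≤ Λ * Real.sqrt (φ ⬝ᵥ φ)))
    {F : ℝ} (hF0 : 0 ≤ F) (hF : ∀ i : I, src blk ℱ {i} ⬝ᵥ src blk ℱ {i} ≤ F ^ 2)
    {c₀ : ℝ} (hc₀ : 0 < c₀) (hcb : ∀ b ∈ B, c₀ ≤ c b) (hV : ∀ Y ∈ Ys, Measurable (V Y)) {KY : υ → ℝ} (hK : ∀ Y ∈ Ys, ∀ φ, |V Y φ| ≤ KY Y)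
    (hek : 0 < ek) (hek1 : ek < Real.exp (-1))
    (hΦloc : ∀ b : B, ∀ φ ψ : α → ℝ, (∀ x, blk x = cube (Sum.inl b) → φ x = ψ x) → Φ b φ = Φ b ψ)
    (hVloc : ∀ Y : Ys, ∀ φ ψ : α → ℝ, (∀ x, blk x = cube (Sum.inr Y) → φ x = ψ x) → V Y φ = V Y ψ)
    (F' : I → (α → ℝ) → ℝ) (hFloc : ∀ i (φ ψ : α → ℝ), (∀ x, blk x = i → φ x = ψ x) → F' i φ = F' i ψ)
    {L' : Type} [Fintype L'] [DecidableEq L'] {nbar : ℕ} (hL : Fintype.card L' = nbar + 1)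
    (W Bl : Finset I) (Vconst PL : ℝ) (W6pp : Finset (Finset I) → Finset I → ℝ)
    -- the one-cube regime of `BIJ88Ineq5144OneCube`, tail constants `A = 4e^{F²/(2m)}`, `κ = m/(8Λ²)`
    {C : ℝ} (hC1 : 1 ≤ C)
    (hC : ∀ i, i ≤ nbar + 1 → ∀ (A : ℝ) ⦃q e t : ℝ⦄, q ≠ 0 → 0 < e → 0 < t → t * e ≤ Real.exp (-1) →
      |iteratedDeriv i (fun s => cutoff χ (q * pLog p (s * e)) A) t| ≤ C * t ^ (-(i : ℤ)))
    {K₁ : ℝ} (hK₁0 : 0 ≤ K₁) (hK₁ : ∀ Y ∈ Ys, KY Y ≤ K₁) {G : ℕ} (hG : ∀ i, (univ.filter fun τ : ↥B ⊕ ↥Ys => cube τ = i).card ≤ G)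
    (hekθ : ek ≤ θ) (hreg : ((nbar + 1 : ℕ) : ℝ) + 1 ≤ m / (8 * Λ ^ 2) * (81 / 100) * c₀ ^ 2 * Real.log ek⁻¹ ^ (2 * p - 1))
    (hpre : C ^ (nbar + 1) * (4 * Real.exp (F ^ 2 / (2 * m))) * Real.exp (G * K₁) * ek ≤ 1) (hKθ : ∀ Y ∈ Ys, KY Y * Real.exp (G * K₁) ≤ θ)
    (hvac : Real.exp (G * K₁) * G * (4 * Real.exp (F ^ 2 / (2 * m))) * ek + (Real.exp (G * K₁) - 1) ≤ θ ^ β')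
    -- (5.14.4) on the polymers with at least two cubes, located reading, for the data of every sub-region of `Λ₁₂` at every `t ∈ (0,1]`
    (h5144two : ∀ ρ ∈ (outer W Bl).filter (IsAdmissible adj), ∀ X' ⊆ lam12 W ρ, ∀ t ∈ Set.Ioc (0 : ℝ) 1,
      ∀ γ' : L' → ↥(slotB B Ys cube X') ⊕ ↥(slotY B Ys cube X'), ∀ (H : Finset L') (X'' : Finset I), 2 ≤ X''.card →
        |locAct (cubeIn cube X' ∘ γ') (actIn blk Δ ℱ adj χ p ek B Φ c Ys V cube (lam12' adj W ρ) X' t γ') H X''| ≤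
          θ ^ ((H.card : ℝ) + β' * ((X'' \ H.image (cubeIn cube X' ∘ γ')).card : ℝ)))
    (h311 : ∀ ρ ∈ (outer W Bl).filter (IsAdmissible adj),
      Vconst + pertP (fun t => Real.log (ztIn blk Δ ℱ χ p ek B Φ c Ys V cube (lam12 W ρ) (lam12' adj W ρ) t)) nbar =
        PL + ∑ X' : Finset I, W6pp ρ X') :
    Real.exp (-Vconst) * expect blk Δ ℱ (fun i φ => fD (uD χ p ek B Φ c Ys V 1) cube γ ∅ i φ * F' i φ) W (corner ℝ W) =
      ∑ ρ ∈ (outer W Bl).filter (IsAdmissible adj),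
        (∏ X ∈ ρ, g1 adj (zG blk Δ ℱ (fun i φ => fD (uD χ p ek B Φ c Ys V 1) cube γ ∅ i φ * F' i φ)) X) *
          (zG blk Δ ℱ (fun i φ => fD (uD χ p ek B Φ c Ys V 1) cube γ ∅ i φ * F' i φ) (lam12 W ρ) (lam12' adj W ρ) /
              zG blk Δ ℱ (fD (uD χ p ek B Φ c Ys V 1) cube γ ∅) (lam12 W ρ) (lam12' adj W ρ) *
            Real.exp (-PL - ∑ X' : Finset I,
              (W6v blk Δ ℱ adj χ p ek B Φ c Ys V cube (lam12' adj W ρ) (lam12 W ρ) L' nbar X' + W6pp ρ X'))) := by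
  obtain ⟨hc1, hc2⟩ := tail_constants_eq hm hΛ F
  have htail : ∀ (i : I) (b : ↥B), cube (Sum.inl b) = i → ∀ a : ℝ, 0 ≤ a →
      (fieldLaw blk Δ ℱ {i}).real {ω | a ≤ |Φ b (ext blk {i} ω)|} ≤ 4 * Real.exp (F ^ 2 / (2 * m)) * Real.exp (-(m / (8 * Λ ^ 2) * a ^ 2)) := by
    intro i b _ a ha
    obtain ⟨ℓ₁, ℓ₂, h₁, h₂, h, hΛ₁, hΛ₂⟩ := hmod b b.2
    rw [← hc1, ← hc2]
    exact tail_slotField_fieldLaw_of_struct blk Δ ℱ {i} hΔ hm hΔm h₁ h₂ h hΛ hΛ₁ hΛ₂ hF0 (hF i) ha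
  exact eq5145_zG_mod_W6v_of_ineq5144_two_le blk Δ ℱ adj χ cube γ hR hD hnbr hθ0 hθ1 hβ hsmall hΔadj hΔ hχ hp
    (fun b hb => by obtain ⟨ℓ₁, ℓ₂, h₁, h₂, h, -, -⟩ := hmod b hb; exact ⟨ℓ₁, ℓ₂, h₁, h₂, h⟩) hc₀ hcb hV hK hek hek1 hΦloc hVloc F'
    hFloc hL W Bl Vconst PL W6pp hC1 hC hK₁0 hK₁ hG (by positivity) (by positivity) htail hekθ hreg hpre hKθ hvac h5144two h311

end Head

/-! ## §2 A kernel certificate with a uniform threshold `e₀(p, n̄, D)` -/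

/-- **KERNEL CERTIFICATE OF §1 WITH A THRESHOLD CHOSEN BEFORE THE DATUM**: for `p > 1/2`, `n̄`, `D` there is `e₀ > 0` such that for every finite
cube set `I`, every symmetric abutting relation of degree `≤ D`, every cube map of the form `Sum.inl b ↦ b`, every cube-local `F`, every
`e_k ∈ (0, e₀)`, every `W`, `B_large`, `|L′| = n̄+1`, `γ`, the (5.14.5) identity of the head holds for the data «sites = cubes, `Δ = 1`, `ℱ = 0`, one
linear χ-slot per cube (the site field), `c ≡ 1`, no interaction terms, `χ = gevreyCutoff`, `𝒫^L = 0`, `W₆″_ρ(X′) = [X′ = ∅]·𝒫̃_ρ`» — every hypothesis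
of `eq5145_zG_mod_W6v_of_ineq5144_two_le_struct` discharged with the ABSOLUTE structural constants `m = Λ = 1`, `F = 0` (`A = 4`, `κ = 1/8`),
`θ = √e_k`, `β′ = 1`, the all-orders constant `Ĉ(gevreyCutoff, p, n̄+1)`, the multi-cube leaf by block-diagonality
(`BIJ88Eq5145HeadMultiCubeSlots.abs_locAct_actIn_le_of_two_le`). [cite: BalabanImbrieJaffe1988, (5.14.5) p.312; (5.14.4) p.309; p.307 (Sect. 5.13)] -/
theorem eq5145_two_le_struct_instance_uniform {p : ℝ} (hp : 1 / 2 < p) (nbar D : ℕ) :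
    ∃ e₀ : ℝ, 0 < e₀ ∧ ∀ {I : Type} [Fintype I] [DecidableEq I] (adj : I → I → Prop) [DecidableRel adj] {nbr : I → Finset I},
      (∀ x y, adj x y → adj y x) → (∀ x, (nbr x).card ≤ D) → (∀ x y, adj x y → y ∈ nbr x) →
      ∀ {cube : ↥(univ : Finset I) ⊕ ↥(∅ : Finset I) → I} (_ : ∀ b, cube (Sum.inl b) = b.1)
        (F : I → (I → ℝ) → ℝ) (_ : ∀ i (φ ψ : I → ℝ), (∀ x, x = i → φ x = ψ x) → F i φ = F i ψ) ⦃e : ℝ⦄, 0 < e → e < e₀ →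
      ∀ (W Bl : Finset I) {L' : Type} [Fintype L'] [DecidableEq L'] (_ : Fintype.card L' = nbar + 1)
        {L : Type} (γ : L → ↥(univ : Finset I) ⊕ ↥(∅ : Finset I)),
        Real.exp (-0) * expect (id : I → I) (1 : Matrix I I ℝ) (0 : I → ℝ)
            (fun i φ => fD (uD gevreyCutoff p e (univ : Finset I) (fun (i : I) (φ : I → ℝ) => φ i) (fun _ => (1 : ℝ))
              (∅ : Finset I) (fun (_ : I) (_ : I → ℝ) => (0 : ℝ)) 1) cube γ ∅ i φ * F i φ) W (corner ℝ W) =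
          ∑ ρ ∈ (outer W Bl).filter (IsAdmissible adj),
            (∏ X ∈ ρ, g1 adj (zG (id : I → I) (1 : Matrix I I ℝ) (0 : I → ℝ)
              (fun i φ => fD (uD gevreyCutoff p e (univ : Finset I) (fun (i : I) (φ : I → ℝ) => φ i) (fun _ => (1 : ℝ))
                (∅ : Finset I) (fun (_ : I) (_ : I → ℝ) => (0 : ℝ)) 1) cube γ ∅ i φ * F i φ)) X) *
              (zG (id : I → I) (1 : Matrix I I ℝ) (0 : I → ℝ)
                  (fun i φ => fD (uD gevreyCutoff p e (univ : Finset I) (fun (i : I) (φ : I → ℝ) => φ i) (fun _ => (1 : ℝ))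
                    (∅ : Finset I) (fun (_ : I) (_ : I → ℝ) => (0 : ℝ)) 1) cube γ ∅ i φ * F i φ) (lam12 W ρ) (lam12' adj W ρ) /
                  zG (id : I → I) (1 : Matrix I I ℝ) (0 : I → ℝ)
                    (fD (uD gevreyCutoff p e (univ : Finset I) (fun (i : I) (φ : I → ℝ) => φ i) (fun _ => (1 : ℝ))
                      (∅ : Finset I) (fun (_ : I) (_ : I → ℝ) => (0 : ℝ)) 1) cube γ ∅) (lam12 W ρ) (lam12' adj W ρ) *
                Real.exp (-0 - ∑ X' : Finset I,
                  (W6v (id : I → I) (1 : Matrix I I ℝ) (0 : I → ℝ) adj gevreyCutoff p e (univ : Finset I)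
                      (fun (i : I) (φ : I → ℝ) => φ i) (fun _ => (1 : ℝ)) (∅ : Finset I) (fun (_ : I) (_ : I → ℝ) => (0 : ℝ)) cube
                      (lam12' adj W ρ) (lam12 W ρ) L' nbar X' +
                    (if X' = ∅ then pertP (fun t => Real.log (ztIn (id : I → I) (1 : Matrix I I ℝ) (0 : I → ℝ) gevreyCutoff p e
                      (univ : Finset I) (fun (i : I) (φ : I → ℝ) => φ i) (fun _ => (1 : ℝ)) (∅ : Finset I)
                      (fun (_ : I) (_ : I → ℝ) => (0 : ℝ)) cube (lam12 W ρ) (lam12' adj W ρ) t)) nbar else 0)))) := by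
  classical
  -- the all-orders constant of the profile for the orders `≤ n̄+1` and gen 5's constant `M = 16(D+1)²e²`: both BEFORE the threshold
  obtain ⟨C, hC1, hC⟩ := exists_const_all_orders gevreyCutoff p (nbar + 1)
  set M : ℝ := 16 * ((D : ℝ) + 1) ^ 2 * Real.exp 2 with hM
  have hM0 : 0 < M := by positivity
  have hκ0 : 0 < 1 / (8 * (1 : ℝ) ^ 2) * (81 / 100) * (1 : ℝ) ^ 2 := by positivity
  obtain ⟨δ, hδ, hreg⟩ := exists_threshold (Q := fun x : ℝ =>
      (((nbar + 1 : ℕ) : ℝ) + 1 ≤ 1 / (8 * (1 : ℝ) ^ 2) * (81 / 100) * (1 : ℝ) ^ 2 * Real.log x⁻¹ ^ (2 * p - 1)) ∧ 2 * Real.exp 1 * x ≤ 1 ∧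
        C ^ (nbar + 1) * 4 * x ≤ 1 ∧ 16 * x ≤ 1 ∧ M ^ 4 * x ≤ 1 ∧ x ≤ 1) (by
    filter_upwards [eventually_const_le_mul_log_rpow (((nbar + 1 : ℕ) : ℝ) + 1) _ (2 * p - 1) hκ0 (by linarith),
      eventually_const_mul_le_one (2 * Real.exp 1), eventually_const_mul_le_one (C ^ (nbar + 1) * 4), eventually_const_mul_le_one 16,
      eventually_const_mul_le_one (M ^ 4), eventually_le_one] with x h1 h2 h3 h4 h5 h6
    exact ⟨h1, h2, h3, h4, h5, h6⟩)
  refine ⟨δ, hδ, ?_⟩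
  intro I _ _ adj _ nbr hR hD hnbr cube hcube F hFloc e he heδ W Bl L' _ _ hL L γ
  obtain ⟨h1, h2, h3, h4, h5, h6⟩ := hreg e he heδ
  -- elementary consequences of the regime
  have hek1 : e < Real.exp (-1) := by
    rw [Real.exp_neg, ← one_div, lt_div_iff₀ (Real.exp_pos 1)]
    nlinarith [Real.exp_pos 1]
  have hsq0 : 0 < Real.sqrt e := Real.sqrt_pos.2 he
  have hsq1 : Real.sqrt e ≤ 1 := by rw [← Real.sqrt_one]; exact Real.sqrt_le_sqrt h6
  have hsqrt : e ≤ Real.sqrt e := by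
    calc e = Real.sqrt e * Real.sqrt e := (Real.mul_self_sqrt he.le).symm
      _ ≤ Real.sqrt e * 1 := by gcongr
      _ = Real.sqrt e := mul_one _
  have hsq4 : Real.sqrt e ≤ 1 / 4 := by
    have h16 : e ≤ (1 / 4) ^ 2 := by nlinarith
    calc Real.sqrt e ≤ Real.sqrt ((1 / 4) ^ 2) := Real.sqrt_le_sqrt h16
      _ = 1 / 4 := Real.sqrt_sq (by norm_num)
  have hsmall : 16 * ((D : ℝ) + 1) ^ 2 * (Real.sqrt e ^ ((1 : ℝ) / 2) * Real.exp 2) ≤ 1 := by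
    have hx : e ≤ ((1 / M) ^ 2) ^ 2 := by
      rw [← pow_mul, show 2 * 2 = 4 by norm_num, div_pow, one_pow, le_div_iff₀ (pow_pos hM0 4)]; linarith
    have hs1 : Real.sqrt e ≤ (1 / M) ^ 2 := (Real.sqrt_le_left (by positivity)).2 hx
    have hs2 : Real.sqrt (Real.sqrt e) ≤ 1 / M := (Real.sqrt_le_left (by positivity)).2 hs1
    rw [← Real.sqrt_eq_rpow]
    calc 16 * ((D : ℝ) + 1) ^ 2 * (Real.sqrt (Real.sqrt e) * Real.exp 2) = M * Real.sqrt (Real.sqrt e) := by rw [hM]; ring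
      _ ≤ M * (1 / M) := by gcongr
      _ = 1 := by field_simp
  -- the structural data: `Δ = 1 ≥ 1·1`, slot fields = coordinates (`Λ = 1`), `ℱ = 0` (`F = 0`), one slot per cube
  have hΔm : ∀ φ : I → ℝ, 1 * (φ ⬝ᵥ φ) ≤ φ ⬝ᵥ ((1 : Matrix I I ℝ) *ᵥ φ) := fun φ => by rw [Matrix.one_mulVec, one_mul]
  have hlin : ∀ i : I, IsLinearMap ℝ (fun φ : I → ℝ => φ i) := fun i => (LinearMap.proj (R := ℝ) (φ := fun _ : I => ℝ) i).isLinear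
  have hΛ : ∀ (i : I) (φ : I → ℝ), |φ i| ≤ 1 * Real.sqrt (φ ⬝ᵥ φ) := fun i φ => by
    rw [one_mul]
    refine Real.abs_le_sqrt ?_
    rw [pow_two]
    exact Finset.single_le_sum (f := fun j => φ j * φ j) (fun j _ => mul_self_nonneg (φ j)) (mem_univ i)
  have hF : ∀ i : I, src (id : I → I) (0 : I → ℝ) {i} ⬝ᵥ src (id : I → I) (0 : I → ℝ) {i} ≤ (0 : ℝ) ^ 2 := fun i => by
    simp [BIJ88PolymerRep5134Gauss.src, dotProduct]
  have hG : ∀ i : I, (univ.filter fun τ : ↥(univ : Finset I) ⊕ ↥(∅ : Finset I) => cube τ = i).card ≤ 1 := fun i =>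
    card_le_one.2 fun a ha b hb => by
      obtain ⟨-, ha⟩ := mem_filter.1 ha
      obtain ⟨-, hb⟩ := mem_filter.1 hb
      rcases a with a | a
      · rcases b with b | b
        · rw [hcube] at ha hb
          rw [Subtype.ext (ha.trans hb.symm)]
        · exact absurd b.2 (notMem_empty _)
      · exact absurd a.2 (notMem_empty _)
  -- the regime inequalities in the shape of §1 (`G = 1`, `K₁ = 0`, `m = Λ = 1`, `F = 0`)
  have hpre : C ^ (nbar + 1) * (4 * Real.exp ((0 : ℝ) ^ 2 / (2 * 1))) * Real.exp (((1 : ℕ) : ℝ) * 0) * e ≤ 1 := by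
    have : C ^ (nbar + 1) * (4 * Real.exp ((0 : ℝ) ^ 2 / (2 * 1))) * Real.exp (((1 : ℕ) : ℝ) * 0) * e = C ^ (nbar + 1) * 4 * e := by simp
    rw [this]; exact h3
  have hvac : Real.exp (((1 : ℕ) : ℝ) * 0) * ((1 : ℕ) : ℝ) * (4 * Real.exp ((0 : ℝ) ^ 2 / (2 * 1))) * e + (Real.exp (((1 : ℕ) : ℝ) * 0) - 1) ≤
      Real.sqrt e ^ (1 : ℝ) := by
    have : Real.exp (((1 : ℕ) : ℝ) * 0) * ((1 : ℕ) : ℝ) * (4 * Real.exp ((0 : ℝ) ^ 2 / (2 * 1))) * e + (Real.exp (((1 : ℕ) : ℝ) * 0) - 1) =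
        4 * e := by simp
    rw [this, Real.rpow_one]
    calc 4 * e = (4 * Real.sqrt e) * Real.sqrt e := by rw [mul_assoc, Real.mul_self_sqrt he.le]
      _ ≤ 1 * Real.sqrt e := by gcongr; linarith
      _ = Real.sqrt e := one_mul _
  have hreg' : ((nbar + 1 : ℕ) : ℝ) + 1 ≤ 1 / (8 * (1 : ℝ) ^ 2) * (81 / 100) * (1 : ℝ) ^ 2 * Real.log e⁻¹ ^ (2 * p - 1) := h1
  exact eq5145_zG_mod_W6v_of_ineq5144_two_le_struct (id : I → I) (1 : Matrix I I ℝ) (0 : I → ℝ) adj gevreyCutoff cube γ (θ := Real.sqrt e)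
    (β' := 1) hR hD hnbr hsq0 hsq1 zero_le_one hsmall (fun x y hxy _ => Matrix.one_apply_ne hxy) Matrix.PosDef.one (m := 1) one_pos hΔm
    chi1_nonneg hp (Λ := 1) one_pos
    (fun b _ => ⟨fun φ => φ b, fun φ => φ b, hlin b, hlin b, Or.inl fun _ => rfl, hΛ b, hΛ b⟩) (F := 0) le_rfl hF one_pos (fun _ _ => le_rfl)
    (fun Y hY => absurd hY (notMem_empty Y)) (KY := fun _ => 0) (fun Y hY => absurd hY (notMem_empty Y)) he hek1
    (fun b φ ψ h => h b.1 (by rw [hcube]; rfl)) (fun Y => absurd Y.2 (notMem_empty _)) F (fun i φ ψ h => hFloc i φ ψ fun x hx => h x hx)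
    hL W Bl 0 0
    (fun ρ X' => if X' = ∅ then pertP (fun t => Real.log (ztIn (id : I → I) (1 : Matrix I I ℝ) (0 : I → ℝ) gevreyCutoff p e
      (univ : Finset I) (fun (i : I) (φ : I → ℝ) => φ i) (fun _ => (1 : ℝ)) (∅ : Finset I) (fun (_ : I) (_ : I → ℝ) => (0 : ℝ)) cube
      (lam12 W ρ) (lam12' adj W ρ) t)) nbar else 0)
    hC1 hC (K₁ := 0) le_rfl (fun Y hY => absurd hY (notMem_empty Y)) (G := 1) hG hsqrt hreg' hpre
    (fun Y hY => absurd hY (notMem_empty Y)) hvac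
    (fun ρ _ X' _ t _ γ' H X'' hX'' =>
      abs_locAct_actIn_le_of_two_le (id : I → I) (0 : I → ℝ) adj gevreyCutoff p e (univ : Finset I) (fun (i : I) (φ : I → ℝ) => φ i)
        (fun _ => (1 : ℝ)) (∅ : Finset I) (fun (_ : I) (_ : I → ℝ) => (0 : ℝ)) cube (fun x y hxy => Matrix.one_apply_ne hxy) hsq0 1
        (lam12' adj W ρ) X' t γ' H X'' hX'')
    (fun ρ _ => by simp)

end Literature.MathematicalPhysics.QuantumFieldTheory.BalabanImbrieJaffe1984to88.BIJ88Eq5145HeadStruct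

end
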